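/-
Copyright (c) 2026 the pub-hodgecm-mathlib formalisation cell (harness21).  Prover seat hodgecm-mathlib-R90-CS-p03 (g2), R90-TF section S8 «ContSpec-n½» (dealer R90-CS-plan (g3),
S8-R190 «NEXT = `K2E1ChiArchA32OfRecordU3`», S8-R192 «unit-coupling blocks»): ★ F5's binder `hA32 : A (3∕2) ≠ 0` FOR THE FACTORISED AMPLITUDE OF RECORD `A z := C_f z · ∫_{L_∞}∫_{L⁺_∞} ω_∞^{rec}·ARCH₃^{−z}`,
with the IDENTIFIED archimedean weight `ω_∞^{rec}(Ξ,a) = u·∏_w archUnitaryValue (m_w) 0 (Z_w(Ξ,a) − 1)`, `Z_w − 1 = −(1 + ‖Ξ_w‖²∕2) + i·Im φ_w(δ)·s_w(a)` — from ★ (a-10c) and ONE finite-half letter.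
-/
import Summits.HodgeConjecture.HodgeConjecture.Theorems.K2E1ChiArchNonvanishingOfRecordU3      -- ★ (a-10c): `arch_integral_ne_zero_of_record`
import Summits.HodgeConjecture.HodgeConjecture.Theorems.K2E1HeightBigCellLineFormulaU3        -- ★ (a2)₃: `embedding_im_sq` (`(Im φ_w δ)² = (wδ)²`), `extensionEmbedding_fst_heisZ`, `…_coe_traceZeroLine`
import HarnessLib

/-!
# K2·E1 ∕ R90·S8 — `K2E1ChiArchA32OfRecordU3`: ★ F5's `hA32` FOR THE FACTORISED AMPLITUDE OF RECORD, MODULO ONE FINITE-HALF LETTER AND THE COUPLING RANGE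

Cell `pub/hodgecm-mathlib`, crux h413 = `stmt-HodgeConjecture-24833`, route of record `HCCMUnconditional`; R90-TF section S8 «ContSpec-n½», the F5 block of the (V) ∕ (R)′ OF-RECORD files
(★ p863385 :303–:309, K2E1-p12 FILE A :160–:164): `(A : ℂ → ℂ) (hA : DifferentiableOn ℂ A {1 < Re}) (hsrc : ∀ z, 2 < Re z → q z = A z · c_S(z)) (hA32 : A (3 ∕ 2) ≠ 0)`.  The (V) bytes
bind `A` as a BARE LETTER, so `hA32` does not factor as `∞ × f` until `A` is NAMED.  THE NAMING OF RECORD proposed here (census `R90/S8/CENSUS-A32-OfRecord.R90-CS-p03-g2.md`):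
`A z := C_f z · ∫_{L_∞} ∫_{L⁺_∞} ω_∞^{rec}(Ξ,a)·ARCH₃(Ξ,a)^{−z} dμ_{F,∞} dμ_{E,∞}` with
* `C_f` the FINITE HALF (the constant of ★ (a-2b) times the finite local means at the witness level — R90-C10-p07's ★ FILE 2 ∕ hsrc-of-witnesses currency), ONE letter `hA32f : C_f (3∕2) ≠ 0`;
* `ω_∞^{rec}(Ξ,a) := u · ∏_{w∣∞} archUnitaryValue (m_w) 0 ζ_w(Ξ,a)`, `ζ_w(Ξ,a) := ((−(1 + ‖Ξ_w‖²∕2) : ℝ) : ℂ) + ((Im φ_w(δ)·s_w(a) : ℝ) : ℂ)·I` — THE IDENTIFIED WEIGHT: by ★ p863894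
  `lastRowChar_infiniteIdeles_midBlock_bigCell` (K2E1-p13) the archimedean last-row character of the section of record on the big cell is `∏_w archUnitaryValue (m_w) 0 (Z_w − 1)`,
  `m_w = kμ,w − 2eη,w` (ODD), `t_w = 0`, and by ★ (a2)₃ `extensionEmbedding_fst_heisZ` + `extensionEmbedding_fst_coe_traceZeroLine` the centre coordinate of the Heisenberg chart reads
  `ψ_w(Z_w) = s_w(a)·φ_w(δ) − ‖Ξ_w‖²∕2` with `φ_w(δ)` purely imaginary (★ `embedding_re_eq_zero`), i.e. `Z_w − 1 = ζ_w(Ξ,a)`; `u` is the unit constant `χ₂,∞(det ι(w₀))·(ρ_E ≡ 1)` (★ 3c-E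
  `archRowFactorE_eq_one`); the row «`archSectionE` of record at `ι(w₀)·u(Ξ, θ(a,b))·k` `=` `ω_∞^{rec}(Ξ,a)`» is a row of the UNFOLDING file that pays `hsrc` (not here).
With this naming `hA32` IS `C_f(3∕2)·(∫∫ ω_∞^{rec}·ARCH₃^{−3∕2}) ≠ 0`, and THIS FILE proves it from ★ (a-10c) HEAD-1 (`ε_w = 1`, `β_w = Im φ_w(δ)`, `β_w² = (wδ)²` by ★ `embedding_im_sq`) with
VISIBLE LETTERS exactly: `hm : ∀ w, |m w| ≤ 2` (coupling range; S8-R192: the blocks of record have `m_w` odd, so this is `|m_w| = 1` = `hm1`; `|m_w| ≥ 3` is the (∞-2) shifted-witness estate),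
`hu : u ≠ 0`, `hA32f : C_f (3∕2) ≠ 0`.  THEOREMS ONLY (no `def`, no `instance`, no notation, no named-fact hypothesis, no `sorry`); lane `--supports stmt-HodgeConjecture-24833 --as helper`.
HONEST SCOPE: the naming of `A` and the identification row are the unfolding file's (C10-p07 ∕ p13 ∕ p11); `hρE` does not appear here (it lives in that row).  HONEST LABEL: HC_CM is proved
only modulo the 7 printed citations (2 remaining named inputs: hLiu418 = `stmt-HodgeConjecture-24832`, h413 = `stmt-HodgeConjecture-24833`) until rung 0 closes; REL ≠ ★ ≠ BUILT; this file
asserts no named fact and closes no socket; count-neutral.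

## References
* [MoeglinWaldspurger1995] C. Mœglin, J.-L. Waldspurger, *Spectral Decomposition and Eisenstein Series* (1995): II.1.7, IV.1.11.
* [Langlands1976] R. P. Langlands, *On the Functional Equations Satisfied by Eisenstein Series*, LNM 544 (1976): Appendix (rank one).
* [Patrikis2019] S. Patrikis, *Variations on a theorem of Tate*, Mem. AMS 258 (2019): §2.1.
-/

set_option autoImplicit false
set_option linter.dupNamespace false -- the mandated namespace repeats `HodgeConjecture.HodgeConjecture`

noncomputable section

open MeasureTheory MeasureTheory.Measure NumberField NumberField.InfinitePlace Filter Set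
open scoped Topology
open Literature.NumberTheory.GaloisRepresentations (archUnitaryValue)
open Summit.HodgeConjecture.HodgeConjecture.Cruxes.H413
open Summit.HodgeConjecture.HodgeConjecture.Cruxes.H413.K2E1ChiArchNonvanishingOfRecordU3 (arch_integral_ne_zero_of_record)
open Summit.HodgeConjecture.HodgeConjecture.Cruxes.H413.K2E1HeightBigCellLineFormulaU3 (embedding_im_sq)

namespace Summit.HodgeConjecture.HodgeConjecture.Cruxes.H413.K2E1ChiArchA32OfRecordU3

variable (L : Type) [Field L] [NumberField L] [IsCMField L] {δ : L} (hcδ : IsCMField.complexConj L δ = -δ) (hδ : δ ≠ 0)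
  [MeasurableSpace (InfiniteAdeleRing L)] [BorelSpace (InfiniteAdeleRing L)]
  [MeasurableSpace (InfiniteAdeleRing ↥(maximalRealSubfield L))] [BorelSpace (InfiniteAdeleRing ↥(maximalRealSubfield L))]
  (μE₁ : Measure (InfiniteAdeleRing L)) [μE₁.IsAddHaarMeasure] (μF₁ : Measure (InfiniteAdeleRing ↥(maximalRealSubfield L))) [μF₁.IsAddHaarMeasure]

include hcδ hδ in
/-- **THE ARCHIMEDEAN INTEGRAL OF THE IDENTIFIED WEIGHT OF RECORD IS NON-ZERO AT `3∕2`** (★ (a-10c) HEAD-1 at `ε_w = 1`, `β_w = Im φ_w(δ)` — `β_w² = (wδ)²` by ★ `embedding_im_sq` — and the unit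
constant `u` pulled out of both integrals): for `m : InfinitePlace L → ℤ` with `|m_w| ≤ 2` and `u ≠ 0`,
`∫_{L_∞} ∫_{L⁺_∞} (u·∏_w archUnitaryValue (m_w) 0 ζ_w(Ξ,a))·ARCH₃(Ξ,a)^{−3∕2} dμ_{F,∞} dμ_{E,∞} ≠ 0`. [cite: MoeglinWaldspurger1995, II.1.7, IV.1.11] [cite: Patrikis2019, §2.1] -/
theorem arch_integral_of_record_ne_zero (m : InfinitePlace L → ℤ) (hm : ∀ w, |m w| ≤ 2) (u : ℂ) (hu : u ≠ 0) :
    (∫ Xi : InfiniteAdeleRing L, ∫ a : InfiniteAdeleRing ↥(maximalRealSubfield L),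
      (u * ∏ w : InfinitePlace L, archUnitaryValue (m w) 0 ((((-(1 + ‖Xi w‖ ^ 2 / 2)) : ℝ) : ℂ) +
          (((w.embedding δ).im * ((InfiniteAdeleRing.ringEquiv_mixedSpace ↥(maximalRealSubfield L)) a).1 ⟨w.comap (algebraMap ↥(maximalRealSubfield L) L), K2E1HeightBigCellLineFormulaU2.isReal_comap_maximalRealSubfield L w⟩ : ℝ) : ℂ) * Complex.I)) *
        ((((∏ w : InfinitePlace L, ((1 + ‖(Xi) w‖ ^ 2 / 2) ^ 2 + (w δ) ^ 2 * (((InfiniteAdeleRing.ringEquiv_mixedSpace ↥(maximalRealSubfield L)) a).1 ⟨w.comap (algebraMap ↥(maximalRealSubfield L) L), K2E1HeightBigCellLineFormulaU2.isReal_comap_maximalRealSubfield L w⟩) ^ 2))) : ℝ) : ℂ) ^ (-(3 / 2 : ℂ)) ∂μF₁ ∂μE₁) ≠ 0 := by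
  have h := arch_integral_ne_zero_of_record L hδ μE₁ μF₁ (fun _ => (1 : ℂ)) (fun _ => by rw [norm_one]) (fun _ => one_ne_zero)
    (fun w => (w.embedding δ).im) (fun w => embedding_im_sq L hcδ w) m hm
  simp_rw [one_mul] at h
  simp_rw [mul_assoc, integral_const_mul]
  exact mul_ne_zero hu h

include hcδ hδ in
/-- **HEAD.  ★ F5's `hA32` FOR THE FACTORISED AMPLITUDE OF RECORD**: with `A := fun z => C_f z · ∫_{L_∞}∫_{L⁺_∞} (u·∏_w archUnitaryValue (m_w) 0 ζ_w)·ARCH₃^{−z}` (the naming of record, module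
docstring), `A (3 ∕ 2) ≠ 0` — in ★ F5's binder bytes `A (3 / 2) ≠ 0` — from the THREE VISIBLE LETTERS `hm : ∀ w, |m w| ≤ 2` (coupling range; `= 1` on the blocks of record, S8-R192),
`hu : u ≠ 0` (the unit constant `χ₂,∞(det ι(w₀))`), `hA32f : C_f (3∕2) ≠ 0` (the finite half, R90-C10-p07's currency). [cite: MoeglinWaldspurger1995, II.1.7, IV.1.11] [cite: Langlands1976, Appendix] -/
theorem hA32_of_record (m : InfinitePlace L → ℤ) (hm : ∀ w, |m w| ≤ 2) (u : ℂ) (hu : u ≠ 0) (Cf : ℂ → ℂ) (hA32f : Cf (3 / 2) ≠ 0) :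
    (fun z : ℂ => Cf z * ∫ Xi : InfiniteAdeleRing L, ∫ a : InfiniteAdeleRing ↥(maximalRealSubfield L),
      (u * ∏ w : InfinitePlace L, archUnitaryValue (m w) 0 ((((-(1 + ‖Xi w‖ ^ 2 / 2)) : ℝ) : ℂ) +
          (((w.embedding δ).im * ((InfiniteAdeleRing.ringEquiv_mixedSpace ↥(maximalRealSubfield L)) a).1 ⟨w.comap (algebraMap ↥(maximalRealSubfield L) L), K2E1HeightBigCellLineFormulaU2.isReal_comap_maximalRealSubfield L w⟩ : ℝ) : ℂ) * Complex.I)) *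
        ((((∏ w : InfinitePlace L, ((1 + ‖(Xi) w‖ ^ 2 / 2) ^ 2 + (w δ) ^ 2 * (((InfiniteAdeleRing.ringEquiv_mixedSpace ↥(maximalRealSubfield L)) a).1 ⟨w.comap (algebraMap ↥(maximalRealSubfield L) L), K2E1HeightBigCellLineFormulaU2.isReal_comap_maximalRealSubfield L w⟩) ^ 2))) : ℝ) : ℂ) ^ (-z) ∂μF₁ ∂μE₁) (3 / 2) ≠ 0 := by
  exact mul_ne_zero hA32f (arch_integral_of_record_ne_zero L hcδ hδ μE₁ μF₁ m hm u hu)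

end Summit.HodgeConjecture.HodgeConjecture.Cruxes.H413.K2E1ChiArchA32OfRecordU3

end
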